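import Summits.MatrixMultiplication.MatrixMultiplication.Theses.FourierTwoFamiliesModP
import Literature.Computability.AlgebraicComplexity.SimultaneousDoubleProduct
import Summits.MatrixMultiplication.MatrixMultiplication.Theorems.FourierTwoFamiliesModPPrimeCyclicPowerGainStubFamilyPoint
import Summits.MatrixMultiplication.MatrixMultiplication.Theorems.FourierTwoFamiliesModPPrimeCyclicPowerGainStubAverage
import Summits.MatrixMultiplication.MatrixMultiplication.Theorems.FourierTwoFamiliesModPPrimeCyclicPowerGainThetaPrelim
import Summits.MatrixMultiplication.MatrixMultiplication.Theorems.FourierTwoFamiliesModPPrimeCyclicPowerGainThetaHalfDensity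
import Summits.MatrixMultiplication.MatrixMultiplication.Theorems.FourierTwoFamiliesModPPrimeCyclicPowerGainThetaOrbit
import Summits.MatrixMultiplication.MatrixMultiplication.Theorems.FourierTwoFamiliesModPPrimeCyclicPowerGainThetaShapeCount

/-!
# Line `clique-coclique-direct-sum-clique` — skeleton for crux `PrimeCyclicPowerGain`
(stmt-MatrixMultiplication-14309, route FourierTwoFamiliesModP; crux-plan, round 1; v2 = PRIMAL form;
lead session -1 reshape 2026-08-16: five provable milestone stubs of the bet registered, see `## Registered MILESTONE stubs, session -1`)

**Idea (card `Ideas/clique-coclique-direct-sum-clique.md`, triage r1: 3 × pass).**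
Freeze a difference set `X₀ ⊆ ℤ/p`.  The *conflict graph* `Γ_{X₀}` has as vertices the admissible
blocks `v = (A, B)` (`|A| = |B| = s`, `A ⊕ B` direct (clause (W)), `A − B ⊆ X₀`) and joins `v ≠ w`
unless both cross-difference sets `A − B'`, `A' − B` avoid `X₀`.  A balanced SDPP family with matched
difference set `D = ⋃ⱼ (Aⱼ − Bⱼ)` is exactly an independent set of `Γ_D` (CKSU 2005 Def. 4.1
reformulated; tree `simultaneous_iff_disjoint_sub`), and `ℤ/p` acts on `Γ_{X₀}` by simultaneous
translation.  The line bounds the independence number by the value of the Schrijver–Lovász theta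
BODY of `Γ_{X₀}` (with the Lovász–Schrijver cut `B v w ≤ B v v`), written WITHOUT any SDP notion as
"every feasible kernel `B` has `Σ B ≤ T`": a family `S` gives the feasible point `B_S = 1_{S×S}/|S|`
with `Σ B_S = |S|` (`stub_familyPoint`); by averaging over `ℤ/p` it suffices to bound
translation-INVARIANT feasible kernels (`stub_average` — the card's Transfer: an invariant PSD
kernel is a family of `p` PSD shape × shape Fourier blocks); THE BET is that every invariant
feasible kernel has `Σ B ≤ p·s^{-(1+c)}` for every frozen `X₀` (`stub_thetaBound`, i.e.
`sup_{X₀} ϑ⁺(Γ_{X₀}) ≤ p·s^{-1-c}`).  Calibration proved on paper in `Lines/….md`: the theta body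
already satisfies HalfDensity, `Σ B ≤ p(s+1)/(2s²)` for EVERY `X₀` (the route's L² level), and
`Σ B ≤ p/s²` on a single orbit (the `s²`-clique `A ⊕ B` = the card's `TranslateClassWall`); digit
difference sets force `c < 0.546`.  All content is in mixed shapes.

**Why primal form (v2).** v1 asked for explicit dual certificates `M` (∃-form); v2 asks for the
universally quantified primal bound, which is logically WEAKER (weak duality, provable) yet composes
identically, admits structural/Fourier proofs on `B` (the HalfDensity lift is one), and is refuted by
exhibiting one feasible `B` — exactly what the kit solver (jobs j007660/j007661) outputs as LB.

**Composition.** `PrimeCyclicPowerGain_of : PrimeCyclicPowerGain` is proved below from the three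
stubs (sorries only inside `stub_*`): `X₀ := D`; the family is a set of `n` pairwise-compatible
admissible vertices (`cross_disjoint`, `blocks_injective`), the support predicate is translation
invariant (`support_vadd_iff`), hence `n ≤ p / s^{1+c}`.

**Disproof used** (cdisprove v1–v3 notes on the item; the file itself is not mounted in this jail):
`false_without_W` — (W) is part of admissibility (it makes `A ⊕ B` an `s²`-clique; without it the
theta body only knows the point cliques, value `p/s`); `false_without_X` — (X) IS independence
(`cross_disjoint`); `false_without_balanceB` — balance is part of admissibility;
`…_iff_cyclicPowerGain` / `…_iff_thresholdFree` (primality, `s₀` not load-bearing) — consistent,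
both merely carried; `translate_wall` — the single-orbit calibration; `Digit.digit_design ⇒ c < 0.546`
— the bet is for small `c` only (`T ≥ α(Γ_D) ≥ p·s^{-1.546}` on digit difference sets).
-/

namespace Summit.MatrixMultiplication.MatrixMultiplication.Cruxes.PrimeCyclicPowerGain.CliqueCocliqueDirectSumClique

open Finset
open scoped Pointwise BigOperators
open Summit.MatrixMultiplication.MatrixMultiplication.Theses.FourierTwoFamiliesModP (PrimeCyclicPowerGain)

/-! ## Registered stubs -/

/-- **stub_familyPoint** (LANDED p73363: `Theorems…PrimeCyclicPowerGainTheta.FamilyPoint.stub_familyPoint`; the easy direction `α ≤ ϑ⁺`, provable now, size S–M).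
A finite set `S` of pairwise `P`-related vertices is a feasible point of the relaxation:
`B_S v w = [v ∈ S][w ∈ S]/|S|` is symmetric, PSD (`x ↦ (Σ_{v∈S} x_v)²/|S|`), nonnegative,
diagonally dominant, supported in `P`, of trace `1`, and `Σ B_S = |S|`; so a uniform bound `T` on
feasible kernels bounds `|S|`. -/
theorem stub_familyPoint :
    ∀ (V : Type) [Fintype V] (P : V → V → Prop) (T : ℝ) (S : Finset V),
      0 ≤ T →
      (∀ v ∈ S, ∀ w ∈ S, P v w) →
      (∀ B : V → V → ℝ,
          (∀ v w, B v w = B w v) →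
          (∀ x : V → ℝ, 0 ≤ ∑ v, ∑ w, x v * B v w * x w) →
          (∀ v w, 0 ≤ B v w) →
          (∀ v w, B v w ≤ B v v) →
          (∀ v w, B v w ≠ 0 → P v w) →
          ∑ v, B v v = 1 →
          ∑ v, ∑ w, B v w ≤ T) →
      (S.card : ℝ) ≤ T := by
  exact Summit.MatrixMultiplication.MatrixMultiplication.Theorems.PrimeCyclicPowerGainTheta.FamilyPoint.stub_familyPoint

/-- **stub_average** (LANDED p73777: `Theorems…PrimeCyclicPowerGainTheta.Average.stub_average`; symmetrisation = the card's Transfer, provable now, size M).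
`ℤ/p` acts on a finite `V` and the support predicate `P` is invariant.  If every
translation-INVARIANT feasible kernel has `Σ B ≤ T`, then every feasible kernel does: replace `B` by
`B̄ v w = p⁻¹ Σ_t B (t +ᵥ v) (t +ᵥ w)`, which is invariant, stays feasible (each constraint is
invariant; `v ↦ t +ᵥ v` is a bijection, `AddAction.injective`/`Fintype.sum_equiv`), and has the same
trace and the same total sum. -/
theorem stub_average :
    ∀ (p : ℕ) [Fact p.Prime] (V : Type) [Fintype V] [AddAction (ZMod p) V]
      (P : V → V → Prop) (T : ℝ),
      (∀ (t : ZMod p) (v w : V), P (t +ᵥ v) (t +ᵥ w) ↔ P v w) →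
      (∀ B : V → V → ℝ,
          (∀ (t : ZMod p) (v w : V), B (t +ᵥ v) (t +ᵥ w) = B v w) →
          (∀ v w, B v w = B w v) →
          (∀ x : V → ℝ, 0 ≤ ∑ v, ∑ w, x v * B v w * x w) →
          (∀ v w, 0 ≤ B v w) →
          (∀ v w, B v w ≤ B v v) →
          (∀ v w, B v w ≠ 0 → P v w) →
          ∑ v, B v v = 1 →
          ∑ v, ∑ w, B v w ≤ T) →
      ∀ B : V → V → ℝ,
          (∀ v w, B v w = B w v) →
          (∀ x : V → ℝ, 0 ≤ ∑ v, ∑ w, x v * B v w * x w) →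
          (∀ v w, 0 ≤ B v w) →
          (∀ v w, B v w ≤ B v v) →
          (∀ v w, B v w ≠ 0 → P v w) →
          ∑ v, B v v = 1 →
          ∑ v, ∑ w, B v w ≤ T := by
  exact Summit.MatrixMultiplication.MatrixMultiplication.Theorems.PrimeCyclicPowerGainTheta.Average.stub_average

/-- **stub_thetaBound** — THE BET (open; the line's whole content, size X): a power saving for
FRACTIONAL SDPP families.  For every frozen `X₀ ⊆ ℤ/p`, every translation-invariant kernel `B` on
pairs of `s`-subsets that is symmetric, PSD, nonnegative, diagonally dominant (`B v w ≤ B v v`, the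
Lovász–Schrijver cut), of trace `1`, and supported on pairs `(v, w)` of ADMISSIBLE vertices
(`|v.1| = |v.2| = s`, (W) for `v`, `v.1 − v.2 ⊆ X₀`) that are COMPATIBLE (`v = w`, or `v.1 − w.2` and
`w.1 − v.2` both avoid `X₀`), has `Σ B ≤ p·s^{-(1+c)}`.  Equivalently `sup_{X₀} ϑ⁺(Γ_{X₀}) ≤
p·s^{-1-c}` for the Schrijver theta body with the diagonal cut (invariance is free: `stub_average`).
Known now (line card): `Σ B ≤ p/s` (point cliques), `Σ B ≤ p(s+1)/(2s²)` for every `X₀` (HalfDensity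
lifts to the theta body), `≤ p/s²` on one orbit; digit difference sets force `c < 0.546`.  The
invariant `B` is a family of kernels `b_{σσ'} : ℤ/p → ℝ` on shape pairs whose Fourier transforms
`b̂(ξ)` are PSD `K × K` Hermitian blocks — the workspace for a proof.  Cheapest falsifier: a
feasible invariant `B` with `Σ B` near `p(s+1)/(2s²)` on some `X₀` with many shapes while
`α ≤ p/s²` (kit jobs j007660 / j007661 output exactly such `B` as their LB).  RESULT of j007660
(16 cases, s = 2,3,4, p ≤ 73, K ≤ 72 shapes, intervals / cubes / digit sets / random X₀): the rigorous
bracket for the Schrijver value is BELOW the wall p/s² in every case and within +1.1 of the exact α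
(e.g. s=3, p=37, X₀=[0,12), K=72: α = 3, ϑ′ ∈ [3.01, 3.33]; random |X₀| = 15: α = 2, ϑ′ ∈ [1.997, 2.05])
— the relaxation is nearly tight at accessible sizes; the asymptotic regime s ≥ 24 is untested. -/
theorem stub_thetaBound :
    ∃ c : ℝ, 0 < c ∧ ∃ s₀ : ℕ, ∀ (p : ℕ) [Fact p.Prime] (s : ℕ), s₀ ≤ s →
      ∀ X₀ : Finset (ZMod p),
      ∀ B : Finset (ZMod p) × Finset (ZMod p) → Finset (ZMod p) × Finset (ZMod p) → ℝ,
        (∀ (t : ZMod p) (v w : Finset (ZMod p) × Finset (ZMod p)), B (t +ᵥ v) (t +ᵥ w) = B v w) →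
        (∀ v w, B v w = B w v) →
        (∀ x : Finset (ZMod p) × Finset (ZMod p) → ℝ, 0 ≤ ∑ v, ∑ w, x v * B v w * x w) →
        (∀ v w, 0 ≤ B v w) →
        (∀ v w, B v w ≤ B v v) →
        (∀ v w : Finset (ZMod p) × Finset (ZMod p), B v w ≠ 0 →
            (v.1.card = s ∧ v.2.card = s ∧
              (∀ a ∈ v.1, ∀ a' ∈ v.1, ∀ b ∈ v.2, ∀ b' ∈ v.2,
                  (a - a') + (b - b') = 0 → a = a' ∧ b = b') ∧
              v.1 - v.2 ⊆ X₀) ∧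
            (w.1.card = s ∧ w.2.card = s ∧
              (∀ a ∈ w.1, ∀ a' ∈ w.1, ∀ b ∈ w.2, ∀ b' ∈ w.2,
                  (a - a') + (b - b') = 0 → a = a' ∧ b = b') ∧
              w.1 - w.2 ⊆ X₀) ∧
            (v = w ∨ (Disjoint (v.1 - w.2) X₀ ∧ Disjoint (w.1 - v.2) X₀))) →
        ∑ v, B v v = 1 →
        ∑ v, ∑ w, B v w ≤ (p : ℝ) / (s : ℝ) ^ (1 + c) := by
  sorry

/-! ## Registered MILESTONE stubs of the bet `stub_thetaBound` (lead-held; not used by the composition)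

These two statements are the first milestones of the open stub, typed so that their proofs land through the
gate as `--supports` files matched by name + signature.  They do not feed `PrimeCyclicPowerGain_of`; they
calibrate the relaxation: `stub_thetaHalfDensity` says the theta body already satisfies the route's `L²` bound
`2 s² · Σ B ≤ p (s+1)` (line card, "ϑ-HalfDensity"), so `stub_thetaBound` is exactly "beat the `L²` level by a
power of `s` for fractional families"; `stub_thetaFluctEnergy` is the fluctuation-energy identity its proof
rests on (compatible blocks have disjoint `A`-sides). -/

/-- **stub_thetaFluctEnergy** (milestone 1a, LANDED p75506 as
`Theorems…PrimeCyclicPowerGainTheta.Fluct.stub_thetaFluctEnergy`): for a kernel on block pairs whose nonzero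
entries sit on blocks with first sides of size `s`, pairwise disjoint across distinct blocks,
`Σ_y Σ_{v,w} (1_{v.1}(y) − |v.1|/|G|) B_vw (1_{w.1}(y) − |w.1|/|G|) = s · Σ_v B_vv − (s²/|G|) · Σ_{v,w} B_vw`. -/
theorem stub_thetaFluctEnergy :
    ∀ (G : Type) [AddCommGroup G] [Fintype G] [DecidableEq G] (s : ℕ)
      (B : Finset G × Finset G → Finset G × Finset G → ℝ),
      (∀ v w : Finset G × Finset G, B v w ≠ 0 → v.1.card = s ∧ w.1.card = s) →
      (∀ v w : Finset G × Finset G, B v w ≠ 0 → v ≠ w → Disjoint v.1 w.1) →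
      ∑ y, ∑ v, ∑ w,
          ((if y ∈ v.1 then (1 : ℝ) else 0) - (v.1.card : ℝ) / (Fintype.card G : ℝ)) * B v w *
            ((if y ∈ w.1 then (1 : ℝ) else 0) - (w.1.card : ℝ) / (Fintype.card G : ℝ)) =
        (s : ℝ) * ∑ v, B v v - (s : ℝ) ^ 2 / (Fintype.card G : ℝ) * ∑ v, ∑ w, B v w := by
  exact Summit.MatrixMultiplication.MatrixMultiplication.Theorems.PrimeCyclicPowerGainTheta.Fluct.stub_thetaFluctEnergy

/-- **stub_thetaHalfDensity** (milestone 1, LANDED p75644 as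
`Theorems…PrimeCyclicPowerGainTheta.HalfDensity.stub_thetaHalfDensity`): `ϑ`-HalfDensity — with the bet's
vertex type and support hypothesis verbatim, every symmetric PSD trace-one kernel has
`2 s² · Σ_{v,w} B v w ≤ p (s + 1)` (invariance, nonnegativity, dominance not needed). -/
theorem stub_thetaHalfDensity :
    ∀ (p : ℕ) [NeZero p] (s : ℕ), 1 ≤ s → ∀ (X₀ : Finset (ZMod p))
      (B : Finset (ZMod p) × Finset (ZMod p) → Finset (ZMod p) × Finset (ZMod p) → ℝ),
      (∀ v w, B v w = B w v) →
      (∀ x : Finset (ZMod p) × Finset (ZMod p) → ℝ, 0 ≤ ∑ v, ∑ w, x v * B v w * x w) →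
      (∀ v w : Finset (ZMod p) × Finset (ZMod p), B v w ≠ 0 →
        (v.1.card = s ∧ v.2.card = s ∧
          (∀ a ∈ v.1, ∀ a' ∈ v.1, ∀ b ∈ v.2, ∀ b' ∈ v.2, (a - a') + (b - b') = 0 → a = a' ∧ b = b') ∧
          v.1 - v.2 ⊆ X₀) ∧
        (w.1.card = s ∧ w.2.card = s ∧
          (∀ a ∈ w.1, ∀ a' ∈ w.1, ∀ b ∈ w.2, ∀ b' ∈ w.2, (a - a') + (b - b') = 0 → a = a' ∧ b = b') ∧
          w.1 - w.2 ⊆ X₀) ∧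
        (v = w ∨ (Disjoint (v.1 - w.2) X₀ ∧ Disjoint (w.1 - v.2) X₀))) →
      ∑ v, B v v = 1 →
      2 * (s : ℝ) ^ 2 * ∑ v, ∑ w, B v w ≤ (p : ℝ) * ((s : ℝ) + 1) := by
  exact Summit.MatrixMultiplication.MatrixMultiplication.Theorems.PrimeCyclicPowerGainTheta.HalfDensity.stub_thetaHalfDensity

/-- **stub_thetaOrbitBound** (milestone 2a of the bet, LANDED p76270 as `Theorems…PrimeCyclicPowerGainTheta.Orbit.stub_thetaOrbitBound`; abstract shape-count bound).  `ZMod p`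
(`p` prime) acts on a finite `V`; `B` invariant, symmetric, PSD, trace `1`; the diagonal support of `B` is covered by
the orbits of a finite set `SH` of representatives in distinct free orbits, each carrying a clique transversal `T σ`
of size `m` (distinct `t, t' ∈ T σ` ⇒ `B (t +ᵥ σ) (t' +ᵥ σ) = 0`).  Then `m · Σ B ≤ |SH| · p` (single-orbit wall
`m·Σ_{t,t'} B(t+σ)(t'+σ) ≤ p·Σ_t B(t+σ)(t+σ)` from PSD at `1_orbit − λ 1_T`, plus polarisation across orbits). -/
theorem stub_thetaOrbitBound :
    ∀ (p : ℕ) [Fact p.Prime] (V : Type) [Fintype V] [DecidableEq V] [AddAction (ZMod p) V]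
      (B : V → V → ℝ) (SH : Finset V) (T : V → Finset (ZMod p)) (m : ℕ),
      (∀ (t : ZMod p) (v w : V), B (t +ᵥ v) (t +ᵥ w) = B v w) →
      (∀ v w, B v w = B w v) →
      (∀ x : V → ℝ, 0 ≤ ∑ v, ∑ w, x v * B v w * x w) →
      ∑ v, B v v = 1 →
      (∀ v, B v v ≠ 0 → ∃ σ ∈ SH, ∃ t : ZMod p, v = t +ᵥ σ) →
      (∀ σ ∈ SH, ∀ σ' ∈ SH, ∀ t : ZMod p, t +ᵥ σ = σ' → σ = σ') →
      (∀ σ ∈ SH, ∀ t : ZMod p, t +ᵥ σ = σ → t = 0) →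
      (∀ σ ∈ SH, (T σ).card = m) →
      (∀ σ ∈ SH, ∀ t ∈ T σ, ∀ t' ∈ T σ, t ≠ t' → B (t +ᵥ σ) (t' +ᵥ σ) = 0) →
      (m : ℝ) * ∑ v, ∑ w, B v w ≤ (SH.card : ℝ) * p := by
  exact Summit.MatrixMultiplication.MatrixMultiplication.Theorems.PrimeCyclicPowerGainTheta.Orbit.stub_thetaOrbitBound

/-- **stub_thetaShapeCount** (milestone 2b of the bet, LANDED p76313 as `Theorems…PrimeCyclicPowerGainTheta.ShapeCount.stub_thetaShapeCount`).  With the bet's hypotheses verbatim: if every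
vertex on the diagonal support of the kernel is a translate of a block pair in `SH`, and the members of `SH` are
pairwise non-translates, then `s² · Σ_{v,w} B v w ≤ |SH| · p` — a kernel carried by `K` shapes has value `≤ K p/s²`
(`K = 1`: the fractional `translate_wall`), so the bet can only fail through `≥ s^{1-c}` coherent shapes. -/
theorem stub_thetaShapeCount :
    ∀ (p : ℕ) [Fact p.Prime] (s : ℕ), 1 ≤ s → ∀ (X₀ : Finset (ZMod p))
      (B : Finset (ZMod p) × Finset (ZMod p) → Finset (ZMod p) × Finset (ZMod p) → ℝ)
      (SH : Finset (Finset (ZMod p) × Finset (ZMod p))),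
      (∀ (t : ZMod p) (v w : Finset (ZMod p) × Finset (ZMod p)), B (t +ᵥ v) (t +ᵥ w) = B v w) →
      (∀ v w, B v w = B w v) →
      (∀ x : Finset (ZMod p) × Finset (ZMod p) → ℝ, 0 ≤ ∑ v, ∑ w, x v * B v w * x w) →
      (∀ v w, 0 ≤ B v w) →
      (∀ v w, B v w ≤ B v v) →
      (∀ v w : Finset (ZMod p) × Finset (ZMod p), B v w ≠ 0 →
        (v.1.card = s ∧ v.2.card = s ∧
          (∀ a ∈ v.1, ∀ a' ∈ v.1, ∀ b ∈ v.2, ∀ b' ∈ v.2, (a - a') + (b - b') = 0 → a = a' ∧ b = b') ∧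
          v.1 - v.2 ⊆ X₀) ∧
        (w.1.card = s ∧ w.2.card = s ∧
          (∀ a ∈ w.1, ∀ a' ∈ w.1, ∀ b ∈ w.2, ∀ b' ∈ w.2, (a - a') + (b - b') = 0 → a = a' ∧ b = b') ∧
          w.1 - w.2 ⊆ X₀) ∧
        (v = w ∨ (Disjoint (v.1 - w.2) X₀ ∧ Disjoint (w.1 - v.2) X₀))) →
      ∑ v, B v v = 1 →
      (∀ v, B v v ≠ 0 → ∃ σ ∈ SH, ∃ t : ZMod p, v = t +ᵥ σ) →
      (∀ σ ∈ SH, ∀ σ' ∈ SH, ∀ t : ZMod p, t +ᵥ σ = σ' → σ = σ') →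
      (s : ℝ) ^ 2 * ∑ v, ∑ w, B v w ≤ (SH.card : ℝ) * p := by
  exact Summit.MatrixMultiplication.MatrixMultiplication.Theorems.PrimeCyclicPowerGainTheta.ShapeCount.stub_thetaShapeCount

/-! ## Registered MILESTONE stubs, session -1 (lead-held programme; not used by the composition)

Structure theory of the bet.  By the landed bounds `Σ B ≤ p(s+1)/(2s²)` (`stub_thetaHalfDensity`) and
`s²·Σ B ≤ K·p` (`stub_thetaShapeCount`), `stub_thetaBound` can only fail through kernels carried COHERENTLY by
`K ≥ s^{1-c}` shapes of one frozen `X₀`.  The five statements below are the provable-now theorems that quantify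
"coherently": (1) the LP-duality-free fractional clique-cover bound (`ϑ ≤ χ̄_f`, square-root-free form);
(2) rectangles `P − Q ⊆ X₀` are cliques of the conflict graph (drefute F2, the lever that settles interval and
box worlds); (3) the convolution-operator bound `‖θ ∗ ·‖ ≤ max_ψ |θ̂(ψ)|` tensored with a PSD form (the one
genuinely Fourier-analytic input); (4) = (3) applied inside the `ϑ`-HalfDensity chain: `ϑ`-CommonFrequencyBias —
a kernel beating the wall `p/s²` forces a nontrivial character at which the trace-weighted matched-difference
function `Δ = Σ_v B_vv 1_{v.1 − v.2}` is biased (the route's support `CommonFrequencyBias` lifted to fractional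
families; with (4) the whole route ladder lives inside the relaxation); (5) = (1)+(2) over the canonical
rectangles `(u − v.2, u − v.1)`: kernels all of whose support pairs have cross-sum intersections
`|(v.1 + w.2) ∩ (w.1 + v.2)| ≥ m` have `m²·Σ B ≤ |G|·s²·tr B` (m = s²: the single-orbit wall for any number of
mutually overlapping shapes) — so coherence needs shape pairs with nearly DISJOINT cross sums. -/

/-- **stub_thetaCliqueCover** (milestone 3, provable now, size M; the fractional clique-cover bound without LP
duality or square roots).  `B` symmetric, PSD, entrywise `≥ 0` on a finite `V`; cliques `C i` with weights
`y i ≥ 0` such that `B` vanishes on distinct vertices of a common clique, every vertex of the diagonal support is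
covered with multiplicity `≥ 1`, and no such vertex with multiplicity `> μ`.  Then `Σ B ≤ μ · (Σ y) · tr B`.
Proof: `B v w ≠ 0 ⇒ B v v, B w w ≠ 0` (PSD 2×2 minors, tree `Orbit.entry_eq_zero_of_diag_eq_zero`), so with
`Y v = Σ_i [v ∈ C i] y i` one has `Σ B ≤ Σ_{v,w} Y v B v w Y w = Σ_{i,j} y_i y_j ⟨1_{C i}, B 1_{C j}⟩`, and
`2⟨1_i, B 1_j⟩ ≤ ⟨1_i,B 1_i⟩ + ⟨1_j, B 1_j⟩` (PSD at `1_i − 1_j`) with `⟨1_i, B 1_i⟩ = Σ_{v ∈ C i} B v v`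
(clique), whence `Σ B ≤ (Σ_i y_i)(Σ_v B v v · Y v) ≤ (Σ y) μ tr B`. -/
theorem stub_thetaCliqueCover :
    ∀ (V : Type) [Fintype V] [DecidableEq V] (ι : Type) [Fintype ι]
      (B : V → V → ℝ) (C : ι → Finset V) (y : ι → ℝ) (μ : ℝ),
      (∀ v w, B v w = B w v) →
      (∀ x : V → ℝ, 0 ≤ ∑ v, ∑ w, x v * B v w * x w) →
      (∀ v w, 0 ≤ B v w) →
      (∀ i, 0 ≤ y i) →
      (∀ i, ∀ v ∈ C i, ∀ w ∈ C i, v ≠ w → B v w = 0) →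
      (∀ v, B v v ≠ 0 → 1 ≤ ∑ i, if v ∈ C i then y i else 0) →
      (∀ v, B v v ≠ 0 → (∑ i, if v ∈ C i then y i else 0) ≤ μ) →
      ∑ v, ∑ w, B v w ≤ μ * (∑ i, y i) * ∑ v, B v v := by
  sorry

/-- **stub_thetaRectangleClique** (milestone 4, provable now, size S; drefute F2 "rectangle cliques" in kernel
form, any additive commutative group).  If `P − Q ⊆ X₀` then two DISTINCT vertices of the support, one meeting `P`
on its `A`-side and the other meeting `Q` on its `B`-side, are incompatible, so the kernel vanishes on the pair:
`a ∈ v.1 ∩ P`, `b ∈ w.2 ∩ Q` give `a − b ∈ (v.1 − w.2) ∩ X₀`, contradicting `Disjoint (v.1 − w.2) X₀`. -/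
theorem stub_thetaRectangleClique :
    ∀ (G : Type) [AddCommGroup G] [DecidableEq G] (s : ℕ) (X₀ P Q : Finset G)
      (B : Finset G × Finset G → Finset G × Finset G → ℝ),
      P - Q ⊆ X₀ →
      (∀ v w : Finset G × Finset G, B v w ≠ 0 →
        (v.1.card = s ∧ v.2.card = s ∧
          (∀ a ∈ v.1, ∀ a' ∈ v.1, ∀ b ∈ v.2, ∀ b' ∈ v.2, (a - a') + (b - b') = 0 → a = a' ∧ b = b') ∧
          v.1 - v.2 ⊆ X₀) ∧
        (w.1.card = s ∧ w.2.card = s ∧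
          (∀ a ∈ w.1, ∀ a' ∈ w.1, ∀ b ∈ w.2, ∀ b' ∈ w.2, (a - a') + (b - b') = 0 → a = a' ∧ b = b') ∧
          w.1 - w.2 ⊆ X₀) ∧
        (v = w ∨ (Disjoint (v.1 - w.2) X₀ ∧ Disjoint (w.1 - v.2) X₀))) →
      ∀ v w : Finset G × Finset G, v ≠ w → (v.1 ∩ P).Nonempty → (w.2 ∩ Q).Nonempty → B v w = 0 := by
  sorry

/-- **stub_thetaConvolutionBound** (milestone 5, provable now, size L; the one Fourier-analytic input of the
programme, finite abelian `G`, characters `AddChar G ℂ`).  For a symmetric PSD real kernel `B` on a finite `W`,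
real functions `h w` on `G`, a real function `θ` on `G` whose character sums are bounded by `M`
(`‖Σ_x θ x ψ x‖ ≤ M` for every `ψ`), convolution by `θ` contracts the `B`-energy by `M²`:
`Σ_{w,w'} B w w' ⟨θ ∗ h_w, θ ∗ h_{w'}⟩ ≤ M² · Σ_{w,w'} B w w' ⟨h_w, h_{w'}⟩`, where `(θ ∗ h)(y) = Σ_x θ x h (y − x)`.
Proof: Plancherel on `G` (`AddChar.sum_apply_eq_ite`: `Σ_ψ ψ a = |G|·[a = 0]`, `AddChar.map_neg_eq_conj`) turns
the left side into `|G|⁻¹ Σ_ψ |θ̂ ψ|² · q ψ` with `q ψ = Σ_{w,w'} B w w' conj(ĥ_w ψ) ĥ_{w'} ψ ≥ 0` (a real PSD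
form is Hermitian-PSD on complex vectors: split real and imaginary parts), and the right side is
`M² |G|⁻¹ Σ_ψ q ψ`. -/
theorem stub_thetaConvolutionBound :
    ∀ (G : Type) [AddCommGroup G] [Fintype G] [DecidableEq G] (W : Type) [Fintype W]
      (B : W → W → ℝ) (h : W → G → ℝ) (θ : G → ℝ) (M : ℝ),
      (∀ w w', B w w' = B w' w) →
      (∀ x : W → ℝ, 0 ≤ ∑ w, ∑ w', x w * B w w' * x w') →
      (∀ ψ : AddChar G ℂ, ‖∑ x, (θ x : ℂ) * ψ x‖ ≤ M) →
      ∑ w, ∑ w', B w w' * ∑ y, (∑ x, θ x * h w (y - x)) * (∑ x, θ x * h w' (y - x)) ≤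
        M ^ 2 * ∑ w, ∑ w', B w w' * ∑ y, h w y * h w' y := by
  sorry

/-- **stub_thetaFrequencyBias** (milestone 6 = `ϑ`-CommonFrequencyBias, provable from milestone 5 and the landed
`ϑ`-HalfDensity chain, size L).  Finite abelian `G`, `s ≥ 1`, a symmetric PSD trace-one kernel with the bet's
support hypothesis verbatim (invariance, nonnegativity, dominance not needed), value `X = Σ B`, and a bound `M ≥ 0` on
the NONTRIVIAL character sums of the trace-weighted matched-difference function
`Δ = Σ_v B v v · 1_{v.1} ∗ 1_{−v.2}` (`Δ̂(ψ) = Σ_v B v v Σ_{a ∈ v.1} Σ_{b ∈ v.2} ψ(a − b)`).  Then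
`s² (s² X − |G|) ≤ M (|G| s − s² X)`: a kernel beating the wall `|G|/s²` by the factor `E = s²X/|G| > 1` forces a
relative bias `M/s² ≥ (E − 1)/(s − E)` at ONE nontrivial frequency (for an actual family `B = 1_{S×S}/n` this is
the route's support item `CommonFrequencyBias` verbatim; `M = s²` recovers `ϑ`-HalfDensity).  Proof: in the landed
chain `s² ≥ Σ Δ² = ⟨F, Δ⟩` (`HalfDensity.F_mul_delta_eq`) write `⟨F, Δ⟩ = s⁴X/|G| + ⟨F, Δ̃⟩`, `Δ̃ = Δ − s²/|G|`,
and `⟨F, Δ̃⟩ = Σ_y Σ_{v,w} f̃_v(y) B v w (Δ̃ ∗ g_w)(y)` with `f̃_v = 1_{v.1} − s/|G|`, `g_w = 1_{−w.2}`; polarisation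
(`Kernel.neg_add_le_two_mul_cross_of_psd` with a free parameter `λ`) bounds it below by
`−(λ P_A + λ⁻¹ P_Δ)/2`, where `P_A = s − s²X/|G|` (`Fluct.fluctA_energy`) and, by milestone 5 with `θ = Δ̃`
(`|Δ̃̂(ψ)| ≤ M` for `ψ ≠ 1`, `= 0` at `ψ = 1`), `P_Δ ≤ M² P_B = M² (s − s²X/|G|)`; take `λ = M` (the case `M = 0`
or `s = E` separately) to get `⟨F, Δ̃⟩ ≥ −M (s − s²X/|G|)`. -/
theorem stub_thetaFrequencyBias :
    ∀ (G : Type) [AddCommGroup G] [Fintype G] [DecidableEq G] (s : ℕ), 1 ≤ s →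
      ∀ (X₀ : Finset G) (B : Finset G × Finset G → Finset G × Finset G → ℝ) (M : ℝ),
      (∀ v w, B v w = B w v) →
      (∀ x : Finset G × Finset G → ℝ, 0 ≤ ∑ v, ∑ w, x v * B v w * x w) →
      (∀ v w : Finset G × Finset G, B v w ≠ 0 →
        (v.1.card = s ∧ v.2.card = s ∧
          (∀ a ∈ v.1, ∀ a' ∈ v.1, ∀ b ∈ v.2, ∀ b' ∈ v.2, (a - a') + (b - b') = 0 → a = a' ∧ b = b') ∧
          v.1 - v.2 ⊆ X₀) ∧
        (w.1.card = s ∧ w.2.card = s ∧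
          (∀ a ∈ w.1, ∀ a' ∈ w.1, ∀ b ∈ w.2, ∀ b' ∈ w.2, (a - a') + (b - b') = 0 → a = a' ∧ b = b') ∧
          w.1 - w.2 ⊆ X₀) ∧
        (v = w ∨ (Disjoint (v.1 - w.2) X₀ ∧ Disjoint (w.1 - v.2) X₀))) →
      ∑ v, B v v = 1 →
      0 ≤ M →
      (∀ ψ : AddChar G ℂ, ψ ≠ 1 →
        ‖∑ v, (B v v : ℂ) * ∑ a ∈ v.1, ∑ b ∈ v.2, ψ (a - b)‖ ≤ M) →
      (s : ℝ) ^ 2 * ((s : ℝ) ^ 2 * (∑ v, ∑ w, B v w) - (Fintype.card G : ℝ)) ≤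
        M * ((Fintype.card G : ℝ) * (s : ℝ) - (s : ℝ) ^ 2 * ∑ v, ∑ w, B v w) := by
  sorry

/-- **stub_thetaCrossSumBound** (milestone 7, provable from milestones 3 + 4, size L; "coherent shapes have
nearly disjoint cross sums").  Finite abelian `G`, a symmetric PSD entrywise-nonnegative kernel with the bet's
support hypothesis verbatim, and `m : ℕ` such that every two vertices of the diagonal support have cross-sum
intersection `|(v.1 + w.2) ∩ (w.1 + v.2)| ≥ m`.  Then `m² · Σ B ≤ |G| · s² · tr B`.  Proof: for `u` in the
support and `x ∈ G` the rectangle `(x − u.2, x − u.1)` has difference set `u.1 − u.2 ⊆ X₀`, so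
`C (u,x) = {w : B w w ≠ 0, (w.1 ∩ (x − u.2)).Nonempty, (w.2 ∩ (x − u.1)).Nonempty}` is a clique (milestone 4);
a support vertex `w` lies in `C (u,x)` iff `x ∈ (w.1 + u.2) ∩ (w.2 + u.1)`, i.e. for exactly
`|(w.1 + u.2) ∩ (w.2 + u.1)| ∈ [m, s²]` values of `x`; with weight `y = 1/(m·#supp)` on each of the `#supp·|G|`
cliques every support vertex is covered with multiplicity in `[1, s²/m]`, and milestone 3 gives
`Σ B ≤ (s²/m)·(|G|/m)·tr B` (`m = 0` is trivial).  With `m = s²` this is the single-orbit wall for any number of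
pairwise fully-overlapping shapes; a kernel beating the wall by `E` needs support pairs with cross-sum intersection
`≤ s²/√E`. -/
theorem stub_thetaCrossSumBound :
    ∀ (G : Type) [AddCommGroup G] [Fintype G] [DecidableEq G] (s m : ℕ) (X₀ : Finset G)
      (B : Finset G × Finset G → Finset G × Finset G → ℝ),
      (∀ v w, B v w = B w v) →
      (∀ x : Finset G × Finset G → ℝ, 0 ≤ ∑ v, ∑ w, x v * B v w * x w) →
      (∀ v w, 0 ≤ B v w) →
      (∀ v w : Finset G × Finset G, B v w ≠ 0 →
        (v.1.card = s ∧ v.2.card = s ∧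
          (∀ a ∈ v.1, ∀ a' ∈ v.1, ∀ b ∈ v.2, ∀ b' ∈ v.2, (a - a') + (b - b') = 0 → a = a' ∧ b = b') ∧
          v.1 - v.2 ⊆ X₀) ∧
        (w.1.card = s ∧ w.2.card = s ∧
          (∀ a ∈ w.1, ∀ a' ∈ w.1, ∀ b ∈ w.2, ∀ b' ∈ w.2, (a - a') + (b - b') = 0 → a = a' ∧ b = b') ∧
          w.1 - w.2 ⊆ X₀) ∧
        (v = w ∨ (Disjoint (v.1 - w.2) X₀ ∧ Disjoint (w.1 - v.2) X₀))) →
      (∀ v w : Finset G × Finset G, B v v ≠ 0 → B w w ≠ 0 → m ≤ ((v.1 + w.2) ∩ (w.1 + v.2)).card) →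
      (m : ℝ) ^ 2 * ∑ v, ∑ w, B v w ≤ (Fintype.card G : ℝ) * (s : ℝ) ^ 2 * ∑ v, B v v := by
  sorry

/-! ## Proved glue (i): the SDPP family is an independent set of the conflict graph of `D` -/

/-- Clause (X) says the cross differences `A i − B k` (`i ≠ k`) avoid the matched difference set
`D = ⋃ⱼ (A j − B j)` (CKSU 2005 Def. 4.1 reformulated; cf. tree `simultaneous_iff_disjoint_sub`). -/
theorem cross_disjoint {p n : ℕ} (A B : Fin n → Finset (ZMod p))
    (hX : ∀ i j k : Fin n, ∀ a ∈ A i, ∀ a' ∈ A j, ∀ b ∈ B j, ∀ b' ∈ B k,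
      (a - a') + (b - b') = 0 → i = k)
    {i k : Fin n} (hik : i ≠ k) :
    Disjoint (A i - B k) (Finset.univ.biUnion fun j => A j - B j) := by
  rw [Finset.disjoint_left]
  intro x hx hx'
  rw [Finset.mem_sub] at hx
  obtain ⟨a, ha, b', hb', rfl⟩ := hx
  rw [Finset.mem_biUnion] at hx'
  obtain ⟨j, -, hj⟩ := hx'
  rw [Finset.mem_sub] at hj
  obtain ⟨a', ha', b, hb, h⟩ := hj
  have h0 : (a - a') + (b - b') = 0 := by
    linear_combination -h
  exact hik (hX i j k a ha a' ha' b hb b' hb' h0)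

/-- Distinct indices carry distinct blocks (from (X) with `j = k` and non-emptiness). -/
theorem blocks_injective {p n s : ℕ} (A B : Fin n → Finset (ZMod p)) (hs : 1 ≤ s)
    (hcard : ∀ i : Fin n, (A i).card = s ∧ (B i).card = s)
    (hX : ∀ i j k : Fin n, ∀ a ∈ A i, ∀ a' ∈ A j, ∀ b ∈ B j, ∀ b' ∈ B k,
      (a - a') + (b - b') = 0 → i = k) :
    Function.Injective (fun i => (A i, B i)) := by
  intro i k hik
  simp only [Prod.mk.injEq] at hik
  obtain ⟨hA, hB⟩ := hik
  have hneA : (A i).Nonempty := by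
    rw [← Finset.card_pos]; have := (hcard i).1; omega
  have hneB : (B i).Nonempty := by
    rw [← Finset.card_pos]; have := (hcard i).2; omega
  obtain ⟨a, ha⟩ := hneA
  obtain ⟨b, hb⟩ := hneB
  exact hX i k k a ha a (hA ▸ ha) b (hB ▸ hb) b (hB ▸ hb) (by simp)

/-! ## Proved glue (ii): admissibility and compatibility are translation invariant -/

section Invariance

variable {p : ℕ}

/-- clause (W) for a block is invariant under translating both sides by `t`. -/
theorem dpp_vadd_iff (t : ZMod p) (A B : Finset (ZMod p)) :
    (∀ a ∈ t +ᵥ A, ∀ a' ∈ t +ᵥ A, ∀ b ∈ t +ᵥ B, ∀ b' ∈ t +ᵥ B,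
        (a - a') + (b - b') = 0 → a = a' ∧ b = b') ↔
    (∀ a ∈ A, ∀ a' ∈ A, ∀ b ∈ B, ∀ b' ∈ B, (a - a') + (b - b') = 0 → a = a' ∧ b = b') := by
  constructor
  · intro h a ha a' ha' b hb b' hb' h0
    have h1 := h (t +ᵥ a) ((Finset.vadd_mem_vadd_finset_iff t).mpr ha) (t +ᵥ a')
      ((Finset.vadd_mem_vadd_finset_iff t).mpr ha') (t +ᵥ b)
      ((Finset.vadd_mem_vadd_finset_iff t).mpr hb)
      (t +ᵥ b') ((Finset.vadd_mem_vadd_finset_iff t).mpr hb')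
      (by simp only [vadd_eq_add]; linear_combination h0)
    simp only [vadd_eq_add, add_right_inj] at h1
    exact h1
  · intro h x hx x' hx' y hy y' hy' h0
    rw [Finset.mem_vadd_finset] at hx hx' hy hy'
    obtain ⟨a, ha, rfl⟩ := hx
    obtain ⟨a', ha', rfl⟩ := hx'
    obtain ⟨b, hb, rfl⟩ := hy
    obtain ⟨b', hb', rfl⟩ := hy'
    have h1 := h a ha a' ha' b hb b' hb'
      (by simp only [vadd_eq_add] at h0; linear_combination h0)
    obtain ⟨rfl, rfl⟩ := h1
    exact ⟨rfl, rfl⟩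

/-- difference sets are invariant: `(t +ᵥ A) − (t +ᵥ B) = A − B`. -/
theorem vadd_sub_vadd (t : ZMod p) (A B : Finset (ZMod p)) :
    (t +ᵥ A) - (t +ᵥ B) = A - B := by
  ext x
  simp only [Finset.mem_sub, Finset.mem_vadd_finset]
  constructor
  · rintro ⟨_, ⟨a, ha, rfl⟩, _, ⟨b, hb, rfl⟩, rfl⟩
    exact ⟨a, ha, b, hb, by simp only [vadd_eq_add]; abel⟩
  · rintro ⟨a, ha, b, hb, rfl⟩
    exact ⟨t +ᵥ a, ⟨a, ha, rfl⟩, t +ᵥ b, ⟨b, hb, rfl⟩, by simp only [vadd_eq_add]; abel⟩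

/-- admissibility of a vertex `v = (A, B)` for `X₀` is translation invariant. -/
theorem adm_vadd_iff (s : ℕ) (X₀ : Finset (ZMod p)) (t : ZMod p)
    (v : Finset (ZMod p) × Finset (ZMod p)) :
    ((t +ᵥ v).1.card = s ∧ (t +ᵥ v).2.card = s ∧
        (∀ a ∈ (t +ᵥ v).1, ∀ a' ∈ (t +ᵥ v).1, ∀ b ∈ (t +ᵥ v).2, ∀ b' ∈ (t +ᵥ v).2,
            (a - a') + (b - b') = 0 → a = a' ∧ b = b') ∧
        (t +ᵥ v).1 - (t +ᵥ v).2 ⊆ X₀) ↔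
    (v.1.card = s ∧ v.2.card = s ∧
        (∀ a ∈ v.1, ∀ a' ∈ v.1, ∀ b ∈ v.2, ∀ b' ∈ v.2,
            (a - a') + (b - b') = 0 → a = a' ∧ b = b') ∧
        v.1 - v.2 ⊆ X₀) := by
  rw [Prod.vadd_fst, Prod.vadd_snd, Finset.card_vadd_finset, Finset.card_vadd_finset,
    dpp_vadd_iff, vadd_sub_vadd]

/-- compatibility of two vertices is translation invariant. -/
theorem compat_vadd_iff (X₀ : Finset (ZMod p)) (t : ZMod p)
    (v w : Finset (ZMod p) × Finset (ZMod p)) :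
    (t +ᵥ v = t +ᵥ w ∨
        (Disjoint ((t +ᵥ v).1 - (t +ᵥ w).2) X₀ ∧ Disjoint ((t +ᵥ w).1 - (t +ᵥ v).2) X₀)) ↔
    (v = w ∨ (Disjoint (v.1 - w.2) X₀ ∧ Disjoint (w.1 - v.2) X₀)) := by
  rw [Prod.vadd_fst, Prod.vadd_snd, Prod.vadd_fst, Prod.vadd_snd, vadd_sub_vadd, vadd_sub_vadd,
    (AddAction.injective t).eq_iff]

/-- the whole support predicate of the relaxation is translation invariant. -/
theorem support_vadd_iff (s : ℕ) (X₀ : Finset (ZMod p)) (t : ZMod p)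
    (v w : Finset (ZMod p) × Finset (ZMod p)) :
    ((((t +ᵥ v).1.card = s ∧ (t +ᵥ v).2.card = s ∧
          (∀ a ∈ (t +ᵥ v).1, ∀ a' ∈ (t +ᵥ v).1, ∀ b ∈ (t +ᵥ v).2, ∀ b' ∈ (t +ᵥ v).2,
              (a - a') + (b - b') = 0 → a = a' ∧ b = b') ∧
          (t +ᵥ v).1 - (t +ᵥ v).2 ⊆ X₀) ∧
        ((t +ᵥ w).1.card = s ∧ (t +ᵥ w).2.card = s ∧
          (∀ a ∈ (t +ᵥ w).1, ∀ a' ∈ (t +ᵥ w).1, ∀ b ∈ (t +ᵥ w).2, ∀ b' ∈ (t +ᵥ w).2,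
              (a - a') + (b - b') = 0 → a = a' ∧ b = b') ∧
          (t +ᵥ w).1 - (t +ᵥ w).2 ⊆ X₀) ∧
        (t +ᵥ v = t +ᵥ w ∨
          (Disjoint ((t +ᵥ v).1 - (t +ᵥ w).2) X₀ ∧ Disjoint ((t +ᵥ w).1 - (t +ᵥ v).2) X₀))) ↔
      ((v.1.card = s ∧ v.2.card = s ∧
          (∀ a ∈ v.1, ∀ a' ∈ v.1, ∀ b ∈ v.2, ∀ b' ∈ v.2,
              (a - a') + (b - b') = 0 → a = a' ∧ b = b') ∧
          v.1 - v.2 ⊆ X₀) ∧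
        (w.1.card = s ∧ w.2.card = s ∧
          (∀ a ∈ w.1, ∀ a' ∈ w.1, ∀ b ∈ w.2, ∀ b' ∈ w.2,
              (a - a') + (b - b') = 0 → a = a' ∧ b = b') ∧
          w.1 - w.2 ⊆ X₀) ∧
        (v = w ∨ (Disjoint (v.1 - w.2) X₀ ∧ Disjoint (w.1 - v.2) X₀)))) := by
  rw [adm_vadd_iff, adm_vadd_iff, compat_vadd_iff]

end Invariance

/-! ## The composition (kernel-checked modulo the stubs) -/

/-- `stub_familyPoint → stub_average → stub_thetaBound → PrimeCyclicPowerGain`: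
with `X₀ := D = ⋃ⱼ (A j − B j)` the family `{(A i, B i)}` is a set of `n` pairwise-compatible
admissible vertices, so the bound on feasible kernels gives `n ≤ p / s^{1+c}`. -/
theorem PrimeCyclicPowerGain_of : PrimeCyclicPowerGain := by
  obtain ⟨c, hc, s₀, hbound⟩ := stub_thetaBound
  refine ⟨c, hc, max s₀ 1, ?_⟩
  intro p hp n s A B hs hcard hW hX
  haveI : Fact p.Prime := ⟨hp⟩
  have hs₀ : s₀ ≤ s := le_trans (le_max_left _ _) hs
  have hs1 : 1 ≤ s := le_trans (le_max_right _ _) hs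
  have hTnn : 0 ≤ (p : ℝ) / (s : ℝ) ^ (1 + c) :=
    div_nonneg (Nat.cast_nonneg _) (Real.rpow_nonneg (Nat.cast_nonneg _) _)
  -- the bet for X₀ := D, then symmetrisation removes the invariance hypothesis
  have hb := hbound p s hs₀ (Finset.univ.biUnion fun j => A j - B j)
  have key := stub_average p (Finset (ZMod p) × Finset (ZMod p)) _ _
    (fun t v w => support_vadd_iff s (Finset.univ.biUnion fun j => A j - B j) t v w) hb
  -- the family as a finset of vertices of the conflict graph
  have hFinj : Function.Injective (fun i => (A i, B i)) := blocks_injective A B hs1 hcard hX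
  have hScard : (Finset.univ.image fun i => (A i, B i)).card = n := by
    rw [Finset.card_image_of_injective _ hFinj, Finset.card_univ, Fintype.card_fin]
  have hP : ∀ v ∈ (Finset.univ.image fun i => (A i, B i)),
      ∀ w ∈ (Finset.univ.image fun i => (A i, B i)),
        ((v.1.card = s ∧ v.2.card = s ∧
            (∀ a ∈ v.1, ∀ a' ∈ v.1, ∀ b ∈ v.2, ∀ b' ∈ v.2,
                (a - a') + (b - b') = 0 → a = a' ∧ b = b') ∧
            v.1 - v.2 ⊆ Finset.univ.biUnion fun j => A j - B j) ∧
          (w.1.card = s ∧ w.2.card = s ∧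
            (∀ a ∈ w.1, ∀ a' ∈ w.1, ∀ b ∈ w.2, ∀ b' ∈ w.2,
                (a - a') + (b - b') = 0 → a = a' ∧ b = b') ∧
            w.1 - w.2 ⊆ Finset.univ.biUnion fun j => A j - B j) ∧
          (v = w ∨ (Disjoint (v.1 - w.2) (Finset.univ.biUnion fun j => A j - B j) ∧
            Disjoint (w.1 - v.2) (Finset.univ.biUnion fun j => A j - B j)))) := by
    intro v hv w hw
    rw [Finset.mem_image] at hv hw
    obtain ⟨i, -, rfl⟩ := hv
    obtain ⟨k, -, rfl⟩ := hw
    refine ⟨⟨(hcard i).1, (hcard i).2, hW i, ?_⟩, ⟨(hcard k).1, (hcard k).2, hW k, ?_⟩, ?_⟩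
    · exact Finset.subset_biUnion_of_mem (fun j => A j - B j) (Finset.mem_univ i)
    · exact Finset.subset_biUnion_of_mem (fun j => A j - B j) (Finset.mem_univ k)
    · by_cases hik : i = k
      · subst hik; exact Or.inl rfl
      · exact Or.inr ⟨cross_disjoint A B hX hik, cross_disjoint A B hX (Ne.symm hik)⟩
  have hn : (n : ℝ) ≤ (p : ℝ) / (s : ℝ) ^ (1 + c) := by
    have h := stub_familyPoint (Finset (ZMod p) × Finset (ZMod p)) _ _ _ hTnn hP key
    rwa [hScard] at h
  have hspos : (0 : ℝ) < (s : ℝ) ^ (1 + c) :=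
    Real.rpow_pos_of_pos (Nat.cast_pos.mpr (by omega)) _
  exact (le_div_iff₀ hspos).mp hn

end Summit.MatrixMultiplication.MatrixMultiplication.Cruxes.PrimeCyclicPowerGain.CliqueCocliqueDirectSumClique
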